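import Literature.Topology.FourManifolds.LefschetzBaseOpenBook
import Literature.Topology.FourManifolds.OpenEmbeddingBoundaryRestrict
import Literature.Topology.FourManifolds.HandleAttachingMapsAssoc
import HarnessLib

/-!
# The Kas tube: the binding tube of `∂ Base g` read in the boundary of a Lefschetz multi-attachment
(brick KOB-1 of node KOB `node_kasOpenBook_of_seamFunction` of the NF6 assembly of stub
`stub_steinRealisation`, line `modp-braid-orbits`, crux `ConvexBisection.AcyclicBisectionExists`,
item stmt-SmoothPoincare4-10508; wave 2, worker V1, lead c5)

Let `X = Base g ∪_{h} (2-handles)` be a Kosinski multi-attachment with data `D`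
(`HandleAttachingMap.MultiAttachmentData`: the open smooth embedding `D.jA` of the cores-complement
`Base g ∖ ⋃ hᵢ(S)`), all attaching circles lying in pages `page g c` of `∂ Base g` (where
`‖w‖ = 1/2`), and `bX` a boundary datum of `X`.  This file builds the single binding tube of the Kas
open book of `∂X`:

* §2 `seamDomain h` — the unsurgered part `{y | incl y ∉ ⋃ hᵢ(S)}` of the boundary 3-manifold
  `∂ Base g` (an open subset of `(bBase g).carrier`), its parametrisation
  `seamBasePt : seamDomain h → Base g ∖ ⋃ hᵢ(S)` of the boundary of the cores-complement (smooth,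
  injective, onto the boundary, open onto the boundary) and the left inverse `seamBaseInv`, smooth on
  the boundary (pattern of `AttachmentBoundaryPieces.lean`, §1);
* §3 `seamTheta h D bX = bX.incl⁻¹ ∘ D.jA ∘ incl : seamDomain h → ∂X`, a smooth embedding with open
  range (`BoundaryData.isSmoothEmbedding_boundaryRestrict_of_boundaryless`), and the **Kas tube**
  `kasTube D bX hpage = seamTheta ∘ tube_{∂ Base g} : 𝕊¹ × ℝ² → ∂X` — W5's binding tube
  `LefschetzBase.tube g` of the base (image `{‖w‖ < 1/4}`, off every core) read in the seam: a
  smooth embedding with open range (`Literature.Geometry.Manifold.isSmoothEmbedding_comp_of_inverse`)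
  with `bX.incl (kasTube q) = D.jA (incl (tube g q))` (`incl_kasTube`) and `w = w̃(v)` along it;
  every seam point `bX.incl y = D.jA a` with `‖w(a)‖ < 1/4` lies on it (`exists_kasTube_eq`);
* `helper_kasTube_of_pages` (registered) — the package in tree vocabulary.

The sequel `…KasOpenBook.lean` adds the fibration `F/‖F‖` of a seam page function `F` and proves
the node.  Everything here is proved; no named facts.

## References
* A. Kas, *On the handlebody decomposition associated to a Lefschetz fibration*, Pacific J. Math.
  89 (1980), 89–104. [Kas1980]
* R. E. Gompf, A. I. Stipsicz, *4-Manifolds and Kirby Calculus*, GSM 20 (1999), §8.2. [GompfStipsicz1999]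
* J. M. Lee, *Introduction to Smooth Manifolds*, 2nd ed. (2013), Prop. 5.2, Thm. 5.11, Cor. 5.30.
  [LeeSmoothManifolds2013]
-/

noncomputable section

-- the prescribed namespace `Summit.<P>.<Sub>.…` duplicates `SmoothPoincare4` (P = Sub)
set_option linter.dupNamespace false

open scoped Manifold ContDiff Topology

namespace Summit.SmoothPoincare4.SmoothPoincare4.Theorems.AcyclicBisectionExists.ModpBraidOrbits

open Set Function
open Literature.Topology.FourManifolds Literature.Topology.FourManifolds.HandleAttachingMap
  Literature.Topology.FourManifolds.LefschetzBase

universe u v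

/-! ### §2 The unsurgered boundary of the base inside the seam `∂X` -/

section Seam

variable {g : ℕ} {ι : Type v} [Finite ι]

/-- A point of the unit circle `𝕊¹ ⊂ ℝ²` (to exhibit points of tubes and carriers). [folklore] -/
def circlePt0 : Metric.sphere (0 : EuclideanSpace ℝ (Fin 2)) 1 :=
  ⟨EuclideanSpace.single 0 1, by simp⟩

/-- **Points of the base with `‖w‖ < 1/4` lie off every attaching circle** when all attaching
circles lie in (flat) pages `page g c`, `‖c‖ = 1` (there `w = c/2` has norm `1/2`). [folklore] -/
theorem mem_coresComplement_of_norm_w_lt (h : ι → HandleAttachingMap 3 2 (Base g))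
    (hpage : ∀ i, ∃ c : ℂ, ‖c‖ = 1 ∧ ∀ θ, (h i).attachingCircle θ ∈ page g c) {x : Base g}
    (hx : ‖w g x.1‖ < 1 / 4) : x ∈ coresComplement h := by
  rw [mem_coresComplement]
  intro i hi
  rw [← range_attachingCircle] at hi
  obtain ⟨θ, rfl⟩ := hi
  obtain ⟨c, hc, hθ⟩ := hpage i
  have hw : w g ((h i).attachingCircle θ).1 = c / 2 := (hθ θ).2
  rw [hw, norm_div, hc] at hx
  norm_num at hx

variable (h : ι → HandleAttachingMap 3 2 (Base g))

/-- **The unsurgered part of `∂ Base g`**: the open set of points of the boundary 3-manifold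
`∂ Base g` lying off all attaching circles `hᵢ(S)`. [folklore] -/
def seamDomain : TopologicalSpace.Opens (bBase g).carrier :=
  ⟨{y | (bBase g).incl y ∈ coresComplement h},
    (coresComplement h).isOpen.preimage (bBase g).continuous_incl⟩

/-- Membership in the unsurgered part. [folklore] -/
theorem mem_seamDomain_iff (y : (bBase g).carrier) :
    y ∈ seamDomain h ↔ (bBase g).incl y ∈ coresComplement h :=
  Iff.rfl

/-- **The parametrisation `∂ Base g ∖ ⋃ hᵢ(S) → Base g ∖ ⋃ hᵢ(S)`, `y ↦ incl y`**, of the boundary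
of the cores-complement by the unsurgered part of the boundary 3-manifold. [folklore] -/
def seamBasePt (y : ↥(seamDomain h)) : ↥(coresComplement h) :=
  ⟨(bBase g).incl y.1, y.2⟩

/-- Its value in `Base g`. [folklore] -/
@[simp] theorem coe_seamBasePt (y : ↥(seamDomain h)) : (seamBasePt h y : Base g) = (bBase g).incl y.1 := rfl

/-- It is smooth. [folklore] -/
theorem contMDiff_seamBasePt : ContMDiff (𝓡 3) (𝓡∂ 4) ∞ (seamBasePt h) := by
  rw [← ContMDiff.subtypeVal_comp_iff]
  exact (bBase g).isSmoothEmbedding.contMDiff.comp contMDiff_subtype_val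

/-- It is injective. [folklore] -/
theorem injective_seamBasePt : Injective (seamBasePt h) := fun _ _ e =>
  Subtype.ext ((bBase g).injective_incl (congrArg (fun a : ↥(coresComplement h) => (a : Base g)) e))

/-- Its values are boundary points of the cores-complement. [folklore] -/
theorem seamBasePt_mem_boundary (y : ↥(seamDomain h)) :
    seamBasePt h y ∈ (𝓡∂ 4).boundary ↥(coresComplement h) := by
  rw [mem_boundary_opens_iff, coe_seamBasePt, ← (bBase g).range_incl]
  exact mem_range_self _

/-- **Every boundary point of the cores-complement is unsurgered-boundary.** [folklore] -/
theorem mem_range_seamBasePt {a : ↥(coresComplement h)}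
    (ha : a ∈ (𝓡∂ 4).boundary ↥(coresComplement h)) : a ∈ range (seamBasePt h) := by
  rw [mem_boundary_opens_iff, ← (bBase g).range_incl] at ha
  obtain ⟨y, hy⟩ := ha
  exact ⟨⟨y, show (bBase g).incl y ∈ coresComplement h from hy ▸ a.2⟩, Subtype.ext hy⟩

/-- **Images of open sets are open pieces of the boundary.** [folklore] -/
theorem exists_image_seamBasePt_eq {U : Set ↥(seamDomain h)} (hU : IsOpen U) :
    ∃ W : Set ↥(coresComplement h), IsOpen W ∧
      seamBasePt h '' U = W ∩ (𝓡∂ 4).boundary ↥(coresComplement h) := by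
  -- adapted from `HandleAttachingMap.exists_image_complementPt_eq`
  -- (Literature/Topology/FourManifolds/AttachmentBoundaryPieces.lean)
  obtain ⟨U₁, hU₁, rfl⟩ := isOpen_induced_iff.1 hU
  obtain ⟨W₀, hW₀, hW₀U⟩ := (bBase g).isSmoothEmbedding.isEmbedding.isInducing.isOpen_iff.1 hU₁
  refine ⟨Subtype.val ⁻¹' W₀, hW₀.preimage continuous_subtype_val, ?_⟩
  ext a
  constructor
  · rintro ⟨y, hy, rfl⟩
    refine ⟨?_, seamBasePt_mem_boundary h y⟩
    show (bBase g).incl y.1 ∈ W₀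
    have : y.1 ∈ (bBase g).incl ⁻¹' W₀ := by rw [hW₀U]; exact hy
    exact this
  · rintro ⟨haW, hab⟩
    obtain ⟨y, rfl⟩ := mem_range_seamBasePt h hab
    refine ⟨y, ?_, rfl⟩
    show y.1 ∈ U₁
    rw [← hW₀U]
    exact haW

open Classical in
/-- **The left inverse `Base g ∖ ⋃ hᵢ(S) → ∂ Base g ∖ ⋃ hᵢ(S)`** (meaningful on the boundary; junk
elsewhere). [folklore] -/
def seamBaseInv [Nonempty ↥(seamDomain h)] (a : ↥(coresComplement h)) : ↥(seamDomain h) :=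
  if hb : ∃ y : ↥(seamDomain h), seamBasePt h y = a then hb.choose else Classical.arbitrary _

/-- `seamBaseInv ∘ seamBasePt = id`. [folklore] -/
theorem seamBaseInv_seamBasePt [Nonempty ↥(seamDomain h)] (y : ↥(seamDomain h)) :
    seamBaseInv h (seamBasePt h y) = y := by
  have hb : ∃ y' : ↥(seamDomain h), seamBasePt h y' = seamBasePt h y := ⟨y, rfl⟩
  unfold seamBaseInv
  rw [dif_pos hb]
  exact injective_seamBasePt h hb.choose_spec

/-- **The left inverse is smooth on the boundary** (there it is `incl⁻¹`,
`BoundaryData.contMDiffOn_inclInv`). [folklore] -/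
theorem contMDiffOn_seamBaseInv [Nonempty ↥(seamDomain h)] :
    ContMDiffOn (𝓡∂ 4) (𝓡 3) ∞ (seamBaseInv h) ((𝓡∂ 4).boundary ↥(coresComplement h)) := by
  -- adapted from `HandleAttachingMap.contMDiffOn_complementInv`
  -- (Literature/Topology/FourManifolds/AttachmentBoundaryPieces.lean)
  haveI : Nonempty (bBase g).carrier := (inferInstance : Nonempty ↥(seamDomain h)).map Subtype.val
  intro a ha
  rw [← ContMDiffWithinAt.subtypeVal_comp_iff]
  have hF : ContMDiffOn (𝓡∂ 4) (𝓡 3) ∞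
      (fun a : ↥(coresComplement h) => (bBase g).inclInv a.1)
      ((𝓡∂ 4).boundary ↥(coresComplement h)) := by
    refine (bBase g).contMDiffOn_inclInv.comp contMDiff_subtype_val.contMDiffOn ?_
    intro a ha
    rw [mem_boundary_opens_iff, ← (bBase g).range_incl] at ha
    exact ha
  refine (hF a ha).congr (fun a' ha' => ?_) ?_
  · obtain ⟨y, rfl⟩ := mem_range_seamBasePt h ha'
    rw [comp_apply, seamBaseInv_seamBasePt, coe_seamBasePt, (bBase g).inclInv_incl]
  · obtain ⟨y, rfl⟩ := mem_range_seamBasePt h ha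
    rw [comp_apply, seamBaseInv_seamBasePt, coe_seamBasePt, (bBase g).inclInv_incl]

/-! ### §3 The identification `Θ : ∂ Base g ∖ ⋃ hᵢ(S) ↪ ∂X` and the Kas tube -/

variable {X : Type u} [TopologicalSpace X] [ChartedSpace (EuclideanHalfSpace 4) X]
  (D : MultiAttachmentData h (𝓡∂ 4) X) (bX : BoundaryData (𝓡∂ 4) X (𝓡 3))

/-- **`Θ = bX.incl⁻¹ ∘ D.jA ∘ (bBase g).incl : ∂ Base g ∖ ⋃ hᵢ(S) → ∂X`**: the unsurgered part of
`∂ Base g` read in the boundary 3-manifold of `X = Base g ∪_{h} (handles)`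
(`BoundaryData.boundaryRestrict`). [folklore] -/
def seamTheta [Nonempty bX.carrier] (y : ↥(seamDomain h)) : bX.carrier :=
  bX.boundaryRestrict D.jA (seamBasePt h) y

/-- **`incl ∘ Θ = jA ∘ incl`.** [folklore] -/
theorem incl_seamTheta [Nonempty bX.carrier] (y : ↥(seamDomain h)) :
    bX.incl (seamTheta h D bX y) = D.jA (seamBasePt h y) :=
  BoundaryData.incl_boundaryRestrict bX D.hjA D.hjAo (seamBasePt_mem_boundary h) y

/-- **`Θ` is a smooth embedding with open range** (restriction of the open smooth embedding
`D.jA` to the boundary, `BoundaryData.isSmoothEmbedding_boundaryRestrict_of_boundaryless`).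
[folklore] -/
theorem isSmoothEmbedding_seamTheta [Nonempty ↥(seamDomain h)] [Nonempty bX.carrier] :
    Manifold.IsSmoothEmbedding (𝓡 3) (𝓡 3) ∞ (seamTheta h D bX) ∧
      IsOpen (range (seamTheta h D bX)) :=
  BoundaryData.isSmoothEmbedding_boundaryRestrict_of_boundaryless bX D.hjA D.hjAo
    (seamBasePt_mem_boundary h) (contMDiff_seamBasePt h)
    (ContinuousLinearEquiv.refl ℝ (EuclideanSpace ℝ (Fin 3))) (injective_seamBasePt h)
    (fun _ hU => exists_image_seamBasePt_eq h hU) (seamBaseInv_seamBasePt h) (contMDiffOn_seamBaseInv h)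

variable {h}

/-- **The base tube lands in the unsurgered part**: `tube g q` has `‖w‖ < 1/4`, off all
attaching circles (which lie in pages, `‖w‖ = 1/2`). [folklore] -/
theorem tube_mem_seamDomain (hpage : ∀ i, ∃ c : ℂ, ‖c‖ = 1 ∧ ∀ θ, (h i).attachingCircle θ ∈ page g c)
    (q : Metric.sphere (0 : EuclideanSpace ℝ (Fin 2)) 1 × EuclideanSpace ℝ (Fin 2)) :
    tube g q ∈ seamDomain h :=
  mem_coresComplement_of_norm_w_lt h hpage (by
    show ‖w g (inclB g (tube g q))‖ < 1 / 4
    rw [w_tube]; exact norm_wTil_lt q.2)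

/-- **The base tube as a map into the unsurgered part.** [folklore] -/
def seamBaseTube (hpage : ∀ i, ∃ c : ℂ, ‖c‖ = 1 ∧ ∀ θ, (h i).attachingCircle θ ∈ page g c)
    (q : Metric.sphere (0 : EuclideanSpace ℝ (Fin 2)) 1 × EuclideanSpace ℝ (Fin 2)) :
    ↥(seamDomain h) :=
  ⟨tube g q, tube_mem_seamDomain hpage q⟩

variable (hpage : ∀ i, ∃ c : ℂ, ‖c‖ = 1 ∧ ∀ θ, (h i).attachingCircle θ ∈ page g c)

/-- Its underlying point of `∂ Base g`. [folklore] -/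
@[simp] theorem coe_seamBaseTube (q : Metric.sphere (0 : EuclideanSpace ℝ (Fin 2)) 1 × EuclideanSpace ℝ (Fin 2)) :
    (seamBaseTube hpage q : (bBase g).carrier) = tube g q := rfl

/-- It is smooth. [folklore] -/
theorem contMDiff_seamBaseTube :
    ContMDiff ((𝓡 1).prod 𝓘(ℝ, EuclideanSpace ℝ (Fin 2))) (𝓡 3) ∞ (seamBaseTube hpage) := by
  rw [← ContMDiff.subtypeVal_comp_iff]
  exact contMDiff_tube g

/-- It is injective. [folklore] -/
theorem injective_seamBaseTube : Injective (seamBaseTube hpage) := fun _ _ e =>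
  tube_injective g (congrArg Subtype.val e)

/-- It is an open map. [folklore] -/
theorem isOpenMap_seamBaseTube : IsOpenMap (seamBaseTube hpage) := fun U hU => by
  have hset : seamBaseTube hpage '' U = Subtype.val ⁻¹' (tube g '' U) := by
    ext z
    constructor
    · rintro ⟨q, hq, rfl⟩
      exact ⟨q, hq, rfl⟩
    · rintro ⟨q, hq, hz⟩
      exact ⟨q, hq, Subtype.ext hz⟩
  rw [hset]
  exact (isOpenMap_tube g U hU).preimage continuous_subtype_val

/-- Its left inverse `tubeInv ∘ val` is smooth on its range. [folklore] -/
theorem contMDiffOn_tubeInv_val :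
    ContMDiffOn (𝓡 3) ((𝓡 1).prod 𝓘(ℝ, EuclideanSpace ℝ (Fin 2))) ∞
      (fun z : ↥(seamDomain h) => tubeInv g z.1) (range (seamBaseTube hpage)) := by
  refine (contMDiffOn_tubeInv g).comp contMDiff_subtype_val.contMDiffOn ?_
  rintro _ ⟨q, rfl⟩
  exact ⟨q, rfl⟩

/-- **The Kas tube `Θ ∘ tube_{∂ Base g} : 𝕊¹ × ℝ² → ∂X`** — W5's binding tube of the base read in
the seam through `Θ`. [folklore] -/
def kasTube [Nonempty bX.carrier]
    (q : Metric.sphere (0 : EuclideanSpace ℝ (Fin 2)) 1 × EuclideanSpace ℝ (Fin 2)) : bX.carrier :=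
  seamTheta h D bX (seamBaseTube hpage q)

/-- **`incl (kasTube q) = jA (incl (tube q))`.** [folklore] -/
theorem incl_kasTube [Nonempty bX.carrier]
    (q : Metric.sphere (0 : EuclideanSpace ℝ (Fin 2)) 1 × EuclideanSpace ℝ (Fin 2)) :
    bX.incl (kasTube D bX hpage q) = D.jA (seamBasePt h (seamBaseTube hpage q)) :=
  incl_seamTheta h D bX _

/-- **The Kas tube is a smooth embedding with open range** (`Θ` after the open embedding
`tube_{∂ Base g}`, `Literature.Geometry.Manifold.isSmoothEmbedding_comp_of_inverse`). [folklore] -/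
theorem isSmoothEmbedding_kasTube [Nonempty ↥(seamDomain h)] [Nonempty bX.carrier] :
    Manifold.IsSmoothEmbedding ((𝓡 1).prod 𝓘(ℝ, EuclideanSpace ℝ (Fin 2))) (𝓡 3) ∞
        (kasTube D bX hpage) ∧
      IsOpen (range (kasTube D bX hpage)) := by
  obtain ⟨h1, h2, -⟩ := Literature.Geometry.Manifold.isSmoothEmbedding_comp_of_inverse
    (isSmoothEmbedding_seamTheta h D bX).1 (isSmoothEmbedding_seamTheta h D bX).2
    (contMDiff_seamBaseTube hpage) (injective_seamBaseTube hpage) (isOpenMap_seamBaseTube hpage)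
    (contMDiffOn_tubeInv_val hpage) (fun q => tubeInv_tube g q) modelEquiv₁₂
  exact ⟨h1, h2⟩

/-- The Kas tube is injective. [folklore] -/
theorem injective_kasTube [Nonempty ↥(seamDomain h)] [Nonempty bX.carrier] :
    Injective (kasTube D bX hpage) :=
  (isSmoothEmbedding_kasTube D bX hpage).1.isEmbedding.injective

/-- **`w` along the Kas tube**: the point `jA⁻¹ (incl (kasTube (p, v)))` of the base has
`w = w̃(v) = wsc v · v`. [folklore] -/
theorem w_seamBasePt_seamBaseTube (q : Metric.sphere (0 : EuclideanSpace ℝ (Fin 2)) 1 × EuclideanSpace ℝ (Fin 2)) :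
    w g ((seamBasePt h (seamBaseTube hpage q) : Base g)).1 = (wsc q.2 : ℂ) * toC q.2 :=
  w_tube g q

/-- **Boundary points of the seam in the image of `jA` with `‖w‖ < 1/4` lie on the Kas tube.**
If `bX.incl y = D.jA a` and `‖w(a)‖ < 1/4` then `y = kasTube q` with `w̃(q.2) = w(a)`. [folklore] -/
theorem exists_kasTube_eq [Nonempty bX.carrier] {y : bX.carrier} {a : ↥(coresComplement h)}
    (hy : bX.incl y = D.jA a) (hw : ‖w g (a : Base g).1‖ < 1 / 4) :
    ∃ q, kasTube D bX hpage q = y ∧ wTil q.2 = w g (a : Base g).1 := by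
  have hab : a ∈ (𝓡∂ 4).boundary ↥(coresComplement h) :=
    (mem_boundary_iff_of_isSmoothEmbedding D.hjA D.hjAo a).1 (by
      rw [← hy, ← bX.range_incl]; exact mem_range_self y)
  rw [mem_boundary_opens_iff, ← (bBase g).range_incl] at hab
  obtain ⟨y₀, hy₀⟩ := hab
  have hw' : ‖w g (inclB g y₀)‖ < 1 / 4 := by
    rw [show inclB g y₀ = (a : Base g).1 from congrArg Subtype.val hy₀]; exact hw
  obtain ⟨q, hq⟩ := exists_tube_eq g hw'
  refine ⟨q, bX.injective_incl ?_, ?_⟩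
  · rw [incl_kasTube, hy]
    congr 1
    apply Subtype.ext
    rw [coe_seamBasePt, coe_seamBaseTube, hq, hy₀]
  · rw [← w_tube g q, hq, show inclB g y₀ = (a : Base g).1 from congrArg Subtype.val hy₀]

end Seam

/-! ### §3b The registered package -/

/-- **The Kas tube of a Lefschetz multi-attachment (registered brick `helper_kasTube_of_pages`).**
For `X = Base g ∪_{h} (2-handles)` with data `D`, all attaching circles in pages, and a boundary
datum `bX` of `X`: there is a smooth embedding `T : 𝕊¹ × ℝ² → ∂X` with open range whose points are
the unsurgered seam points over W5's binding tube of the base, `bX.incl (T q) = D.jA (incl (tube g q))`.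
[cite: Kas1980] -/
theorem helper_kasTube_of_pages : ∀ (g : ℕ) (ι : Type) [Finite ι] (X : Type) [TopologicalSpace X] [ChartedSpace (EuclideanHalfSpace 4) X] (h : ι → Literature.Topology.FourManifolds.HandleAttachingMap 3 2 (Literature.Topology.FourManifolds.LefschetzBase.Base g)) (D : Literature.Topology.FourManifolds.HandleAttachingMap.MultiAttachmentData h (𝓡∂ 4) X) (bX : Literature.Topology.FourManifolds.BoundaryData (𝓡∂ 4) X (𝓡 3)), (∀ i, ∃ c : ℂ, ‖c‖ = 1 ∧ ∀ θ, (h i).attachingCircle θ ∈ Literature.Topology.FourManifolds.LefschetzBase.page g c) → ∃ T : Metric.sphere (0 : EuclideanSpace ℝ (Fin 2)) 1 × EuclideanSpace ℝ (Fin 2) → bX.carrier, Manifold.IsSmoothEmbedding ((𝓡 1).prod 𝓘(ℝ, EuclideanSpace ℝ (Fin 2))) (𝓡 3) ∞ T ∧ IsOpen (Set.range T) ∧ ∀ q, ∃ a : ↥(Literature.Topology.FourManifolds.HandleAttachingMap.coresComplement h), (a : Literature.Topology.FourManifolds.LefschetzBase.Base g) = (Literature.Topology.FourManifolds.LefschetzBase.bBase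 g).incl (Literature.Topology.FourManifolds.LefschetzBase.tube g q) ∧ bX.incl (T q) = D.jA a := by
  intro g ι _ X _ _ h D bX hpage
  haveI : Nonempty ↥(seamDomain h) := ⟨seamBaseTube hpage (circlePt0, 0)⟩
  haveI : Nonempty bX.carrier := by
    have hb : D.jA (seamBasePt h (seamBaseTube hpage (circlePt0, 0))) ∈ range bX.incl := by
      rw [bX.range_incl]
      exact (mem_boundary_iff_of_isSmoothEmbedding D.hjA D.hjAo _).2 (seamBasePt_mem_boundary h _)
    obtain ⟨y, -⟩ := hb
    exact ⟨y⟩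
  exact ⟨kasTube D bX hpage, (isSmoothEmbedding_kasTube D bX hpage).1,
    (isSmoothEmbedding_kasTube D bX hpage).2,
    fun q => ⟨seamBasePt h (seamBaseTube hpage q), rfl, incl_kasTube D bX hpage q⟩⟩

end Summit.SmoothPoincare4.SmoothPoincare4.Theorems.AcyclicBisectionExists.ModpBraidOrbits

end
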